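import Summits.ResolutionOfSingularities.ResolutionOfSingularities.Theorems.ValuativeLupiLaurentBase
import Literature.AlgebraicGeometry.Resolution.AbhyankarEtaleAscentProofs
import Literature.AlgebraicGeometry.Resolution.SmoothImpliesRegular
import HarnessLib

/-!
# Route `Valuative`, item `Lupi` (stmt-ResolutionOfSingularities-0560): Abhyankar places

The conclusion of `Lupi` — `IsLocallyUniformizable k K O` — holds UNCONDITIONALLY, in every
dimension `n` and every characteristic, along every ABHYANKAR place `O` of `K/k` (equality in
Abhyankar's inequality `trdeg K/k = rat.rk + residual trdeg`: prime divisors, monomial valuations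
of maximal rational rank, …) whose residue field extension is separably generated (automatic over
perfect `k`): the tree PROVES Knaf–Kuhlmann 2005, Thm. 1.1 (`KnafKuhlmann2005_Thm11_holds`,
from Kuhlmann's generalized stability theorem) — a model SMOOTH over `k` at the centre — and
"smooth over a field ⇒ regular" (`isRegularLocalRing_of_isSmoothAt`, EGA IV 17.5.8).

* `isLocallyUniformizable_of_isAbhyankarPlace` — for every finitely generated `K/k` (the bridge
  from the `Subfield Ω` vocabulary of the Knaf–Kuhlmann files to `IsLocallyUniformizable`; the
  hypersurface shape of `Lupi` is not used).
* `lupi_isAbhyankarPlace` — the instance for the data of `Lupi`.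

So a counterexample to `Lupi` must use a NON-Abhyankar valuation (room for defect), on top of
`n ≥ 4`, `t ∉ k(x)`, `t ^ p ∉ k` (`ValuativeLupi.lean`, `ValuativeLupiConstantField.lean`).
The translation is adapted from `Cruxes/LuAlphaPTorsor/Disproof.lean` §3d (not importable from
`Theorems/`), simplified to the absolute form (`Z = ∅`).

Log: (1) direct.
-/

-- single-problem summit: the doubled namespace component `ResolutionOfSingularities` is forced
set_option linter.dupNamespace false

open IsLocalRing

namespace Summit.ResolutionOfSingularities.ResolutionOfSingularities.Theorems.Lupi

open Literature.AlgebraicGeometry.Resolution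

variable {k K : Type} [Field k] [Field K] [Algebra k K]

-- adapted from Cruxes/LuAlphaPTorsor/Disproof.lean (§3d)
/-- `Algebra.adjoin` over `k` and over its image subfield `im (k → K)` have the same underlying
subring. -/
theorem adjoin_fieldRange_toSubring (s : Set K) :
    (Algebra.adjoin (algebraMap k K).fieldRange s).toSubring = (Algebra.adjoin k s).toSubring := by
  rw [Algebra.adjoin_eq_ring_closure, Algebra.adjoin_eq_ring_closure]
  congr 1
  ext x
  simp only [Set.mem_union, Set.mem_range]
  constructor
  · rintro (⟨⟨y, ⟨c, rfl⟩⟩, rfl⟩ | hx)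
    · exact Or.inl ⟨c, rfl⟩
    · exact Or.inr hx
  · rintro (⟨c, rfl⟩ | hx)
    · exact Or.inl ⟨⟨algebraMap k K c, ⟨c, rfl⟩⟩, rfl⟩
    · exact Or.inr hx

/-- `K/k` finitely generated, in the `Subfield` vocabulary of the Knaf–Kuhlmann files:
`FGOver (im k) ⊤`. -/
theorem fgOver_top_of_fg (hfg : (⊤ : IntermediateField k K).FG) :
    FGOver (algebraMap k K).fieldRange (⊤ : Subfield K) := by
  obtain ⟨s, hs⟩ := hfg
  refine ⟨s, top_le_iff.mp fun z _ => ?_⟩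
  have hz : z ∈ IntermediateField.adjoin k (s : Set K) := by
    rw [hs]; exact IntermediateField.mem_top
  have hz' : z ∈ (IntermediateField.adjoin k (s : Set K)).toSubfield := hz
  rw [IntermediateField.adjoin_toSubfield k (s : Set K)] at hz'
  rwa [RingHom.coe_fieldRange]

/-- **Abhyankar places are locally uniformizable, unconditionally** (Knaf–Kuhlmann 2005,
Thm. 1.1, PROVED in the tree, + smooth ⇒ regular): for `K/k` finitely generated and a valuation
ring `O ⊇ k` of `K` that is an Abhyankar place of `K/k` with separably generated residue field
extension, `IsLocallyUniformizable k K O`. -/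
theorem isLocallyUniformizable_of_isAbhyankarPlace (hfg : (⊤ : IntermediateField k K).FG)
    (O : ValuationSubring K) (hO : ∀ c : k, algebraMap k K c ∈ O)
    (hAbh : IsAbhyankarPlace O (algebraMap k K).fieldRange ⊤)
    (hsep : SeparablyGeneratedOver (resField O (algebraMap k K).fieldRange) (resField O ⊤)) :
    IsLocallyUniformizable k K O := by
  classical
  set Kf : Subfield K := (algebraMap k K).fieldRange with hKf
  have hKO : ((Kf : Subfield K) : Set K) ⊆ O := by
    rintro _ ⟨c, rfl⟩
    exact hO c
  -- Knaf–Kuhlmann 2005, Thm. 1.1 with `Z = ∅` (PROVED in the tree)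
  obtain ⟨A', hA'O, -, hfp, hfrac', hsm, -⟩ :=
    KnafKuhlmann2005_Thm11_holds K O Kf ⊤ le_top (fgOver_top_of_fg hfg) hKO hAbh hsep ∅
      (by simp)
  haveI := hfp
  haveI := hsm
  -- smooth over a field at the centre ⇒ regular local ring (EGA IV 17.5.8, PROVED in the tree)
  have hreg' : IsRegularLocalRing (Localization.AtPrime (centre A' O hA'O)) :=
    isRegularLocalRing_of_isSmoothAt Kf A' (centre A' O hA'O)
  -- the same model as a `k`-subalgebra
  let A : Subalgebra k K :=
    { A'.toSubring with
      algebraMap_mem' := fun c => A'.algebraMap_mem ⟨algebraMap k K c, ⟨c, rfl⟩⟩ }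
  have hAO : A.toSubring ≤ O.toSubring := hA'O
  have hreg : IsRegularLocalRing (Localization.AtPrime
      ((maximalIdeal O).comap (Subring.inclusion hAO))) := hreg'
  have hAfg : A.FG := by
    haveI : Algebra.FiniteType Kf A' := inferInstance
    obtain ⟨s', hs'⟩ := A'.fg_iff_finiteType.mpr this
    refine ⟨s', Subalgebra.toSubring_injective ?_⟩
    rw [← adjoin_fieldRange_toSubring, hs']
  have hfrA : IsFractionRing A K := by
    refine IsFractionRing.of_field A K fun z => ?_
    obtain ⟨a, ha, b, hb, rfl⟩ := hfrac' z (Subfield.mem_top z)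
    exact ⟨⟨a, ha⟩, ⟨b, hb⟩, rfl⟩
  exact ⟨A, hAO, hAfg, hfrA, hreg⟩

/-- **`Lupi` along Abhyankar places**, every `n`, every `p`, every `k`, unconditionally (in the
item's binder shape, with the two Knaf–Kuhlmann hypotheses on `O`). -/
theorem lupi_isAbhyankarPlace : ∀ p : ℕ, p.Prime → ∀ (k K : Type) [Field k] [CharP k p]
    [Field K] [Algebra k K] (n : ℕ) (x : Fin n → K) (t : K), AlgebraicIndependent k x →
      t ^ p ∈ Algebra.adjoin k (Set.range x) →
      IntermediateField.adjoin k (insert t (Set.range x)) = ⊤ →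
      ∀ O : ValuationSubring K, (∀ c : k, algebraMap k K c ∈ O) →
        IsAbhyankarPlace O (algebraMap k K).fieldRange ⊤ →
        SeparablyGeneratedOver (resField O (algebraMap k K).fieldRange) (resField O ⊤) →
        IsLocallyUniformizable k K O :=
  fun _ _ _ _ _ _ _ _ _ x t _ _ htop O hO hAbh hsep =>
    isLocallyUniformizable_of_isAbhyankarPlace (fg_top_of_adjoin_eq_top x t htop) O hO hAbh hsep

end Summit.ResolutionOfSingularities.ResolutionOfSingularities.Theorems.Lupi
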